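import Literature.MathematicalPhysics.QuantumFieldTheory.Balaban1983to89.B6Grad2LegLettersKLevelV1
import Literature.MathematicalPhysics.QuantumFieldTheory.Balaban1983to89.B6RandomWalkInputNormChain

/-!
# `Balaban1983to89.B6Grad2NormSuppLegKLevelV1` — T. Bałaban, *Propagators and renormalization transformations for lattice gauge theories. II*,
# Commun. Math. Phys. **96** (1984) 223–250 [Balaban1984PropagatorsII], Prop. 2.6 (2.138) p. 247 with (2.141) p. 247, (2.92)–(2.94) p. 239:
# THE `n = 0` LEGS `∇_μ(h_□G_□h_□)∇*_ν` OF THE WALK (2.141) FOR THE ENTRY `|(∇G∇*J)(x)|`, ON THE HÖLDER CLASS OF (2.138), PER CUBE, AT k LEVELS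
# (file (L0) of `HOME/lit-balaban-p27/WAKE-2138-legs.md`)

statement-level skeleton of published theorems with citation tags; proofs where landed; nothing here is a claim about the Yang–Mills mass gap

PDF held: `paper:balaban1984-cmp96-propagators-rt-ii` (journal page = PDF page + 222): p. 239 [PDF 17] (the UNNUMBERED display
*"G₀ = Σ_{□∈𝒟} h_□G_□h_□"* printed between (2.90) *"G_□ = (Δ − ∂P_□∂* + Q*aQ)⁻¹"* and (2.91) *"Δ_aG₀ = I − Σ_{□,□′∈𝒟} K_{□,□′}G_{□′}h_{□′} = I − R"*;
(2.92) line 1: the commutator of `Δ` with `h_□`; (2.94) the rescaling), p. 247 [PDF 25] ((2.138): *"|(∇G∇*J)(x)| ≤ O(1)e^{−δ₃d(y,y′)}(‖J‖^{ξ′}_ε + |J|)"*;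
(2.141): *"G = Σ_ω h_{□₀}G_{□₀}h_{□₀}K_{□₁□₂}G_{□₂}h_{□₂}…"* read for the entry `∇G∇*`: the `n = 0` term is `Σ_□ ∇(h_□G_□h_□)∇*`).  The sizes of the
cut-offs `h_□` (used through the sibling's `lip_shB_hB` ∕ `abs_DV_hB_le`) are printed in [Balaban1983RegularityDecay] (CMP **89**) §2 p. 577 [PDF 7]
*"|∂^ηh_j| ≤ O(M⁻¹), |Δ^ηh_j| ≤ O(M⁻²)"* for the functions (1.118) of [Balaban1984PropagatorsI] p. 36, rescaled as cmp96 p. 229 [PDF 7] prescribes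
(*"the corresponding family of functions h described in (1.118), and rescale them to proper scales"*).  (v1.1 docfix D-g111-2, ref-4 gen 111: the
former header called the `G₀` display "(2.91)"; corrected, no declaration touched.)

CITATION HEADER (lean-in-tree rule) — WHAT IS REPRODUCED.  Phase-2 file of the `lit-balaban` typed skeleton (HOME `run/shared/lean/pub/lit-balaban/`), seat
**p27 gen 90** (TAKING HOME/STATUS 2026-08-24T22:31Z on p38 g34's named offer; `WAKE-2138-legs.md` (L0); B6 fold owner r03); SKELETON rows **B6.Eq2.138** ×
B6.Eq2.141 × B6.Prop2.6 (cells only; decls of record untouched).  The leg `∇_μ(h_□G_□h_□)∇*_ν` is expanded by the lattice product rule on both sides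
(p38's `…B6GradLegKLevelV1.DV_sandwich_eq` / `…B6GDVaLegKLevelV1.GDVa_sandwich_eq`) into FOUR terms (**`grad2_sandwich_eq`**, `s = c′/L^{j₀}`):
`s²·(S_μh)·E_(μ,+)G_□E_(ν,−)·(S_νh)` (BOTH differences on the member: the Hölder-class letter `…B6CubeNormSuppInDecayV1.hEGE_cube`),
`s·(S_μh)·E_(μ,+)G_□·(∇_νh)`, `s·(∇_μh)·G_□E_(ν,−)·(S_νh)` (ONE difference on the member, a SMALL multiplier `|∇h_□| ≤ |c′|C1F/(8S/5)`: sup-class letters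
`hEGin_cube`, `hGEin_cube`), `(∇_μh)·G_□·(∇_νh)` (`hGin_cube`); the sup-class letters are Hölder-class letters because the class size dominates `|J|`
(`hasMajorantA_normSupp_of_sup`), and the Hölder-class letter regains the unrestricted input class through the cut-off `S_νh_□`
(`…B6NormSuppDecayWindowV1.hasMajorantA_mul_right_ind` with `…B6HolderNormV1.normSupp_mulOp`; the block-scale Lipschitz size of `S_νh_□` on admissible
pairs is **`lip_shB_hB`**, from p38's one-step size `abs_hT_sub_le_near` along the staircase `…B6BlockHolderLipschitzV1.pseudoDist_le_path` and p22's
`…B6HolderPairGeometryV1.pair_levels`):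
the letters (sandwiches, `lip_shB_hB`, `grad2_sandwich_eq`) are in the sibling `…B6Grad2LegLettersKLevelV1` (p27, split for the 400-line cap);
* **`hD2hGh0_cube`** — ONE `(ρ, C_ε)` on `d, L, a₀, a₁, ε` such that for every admissible V1 torus (`M_h = Lᵃ ≥ 8`, `R ≥ 2L²`, `P′ ≥ 5`, `L ≥ 5`, cube
  placed), `c′ ≠ 0`, weights, `μ, ν`, cube `□`:
  `HasMajorantA (geomT D) (blkV1 hN D) (NormSupp (blkV1) {y′} (holderV1 ε + supNormV1)) (∇_μ(h_□G_□h_□)∇*_ν) (1_{Q_□}(y)·1_{Q_□}(y′)·C_ε·e^{−ρ d_T(y,y′)})`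
  — print's `O(1)e^{−δ₃d}(‖J‖_ε + |J|)` for the `n = 0` leg, NO length prefactor.
THEOREMS ONLY (no `def`, no `def … : Prop`); standard axioms.  Imports `…B6Grad2LegLettersKLevelV1` (p27), `…B6RandomWalkInputNormChain` (p27).

HONEST SCOPE / DIVERGENCES. (1) Thresholds as in p38's legs (`M_h ≥ 8`, `R ≥ 2L²`, `P′ ≥ 5`, `L ≥ 5`, `k ≤ m + K`, cube placed, `c′ ≠ 0`, `0 < a₀ ≤ a₁`).
(2) Constants and the rate (a `min` of the four letters' rates) are ours; the `O(1)` carries `L³·C1F` factors.  (3) The sum over cubes (bounded overlap,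
`…B6RandomWalkInputNormChain.hasMajorantA_sum_overlap`), the pair legs and the assembly of (2.138) are NOT here.  NOT summit progress.
Unit `lit-balaban-p27` (gen 90), 2026-08-25.
-/

noncomputable section

open scoped BigOperators
open Finset

namespace Literature.MathematicalPhysics.QuantumFieldTheory.Balaban1983to89.B6Grad2NormSuppLegKLevelV1

open B6MultiLevelBoxOperator (N0 bigSide)
open B6Cover236MultiLevelBlocks (cubes)
open B6Geom246MultiLevelBox (bset)
open B6Geom246MultiLevelTorus (geomT)
open B6MultiLevelTorusOperator (TDomains)
open B8Ineq192MultiLevelTorus (geomT_len)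
open B6Eq238MultiLevelTorus (svec)
open B6RandomWalk (HasMajorant BlockSupp)
open B6Prop26Gluing (mulOp ind ind_nonneg ind_of_mem ind_of_not_mem outLoc_mulOp_mul)
open B6GlobalChartV1 (PV toBox blkV1 domT)
open B6SectAOperatorsV1 (BondIdx)
open B6Partition118KLevelFineSizes (C1F C1F_nonneg)
open B6Partition118KLevelTorusCentral (one_le_of_four_le)
open B6Prop26KLevelSkeletonV1 (hB ST pref pref_nonneg abs_hB_le_one)
open B6InMajorantTransplant (InMajorant)
open B6CubeWindowV1 (Placed j0 sc sc_ne_zero Gl)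
open B6Eq292MemberTorusV1 (EC)
open B6CubeInDecayV1 (hGin_cube hEGin_cube sc_nonneg)
open B6CubeRightLegsV1 (hGEin_cube)
open B6GradLegKLevelV1 (shB shB_apply DV pref_scale_le lip_scale_le)
open B6LapLegKLevelV1 (DVa)
open B6RandomWalkInputNorm (HasMajorantA NormSupp hasMajorantA_smul hasMajorantA_mono hasMajorantA_add)
open B6RandomWalkInputNormChain (hasMajorantA_localise_out mulOp_eq_zero_of_region)
open B6HolderNormV1 (supNormV1 holderV1 abs_le_supNormV1 holderV1_nonneg normSupp_mulOp)
open B6NormSuppDecayWindowV1 (hasMajorantA_mul_right_ind)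
open B6CubeNormSuppInDecayV1 (hEGE_cube)

open B6Grad2LegLettersKLevelV1 (hasMajorant_sandwich_in_both hasMajorantA_mulOp_left hasMajorantA_normSupp_of_sup lip_shB_hB len_lip_le
  supp_shB_hB supp_DV_hB abs_DV_hB_le grad2_sandwich_eq)

/-! ## §1  THE `n = 0` LEG `∇_μ(h_□G_□h_□)∇*_ν` ON THE HÖLDER CLASS, PER CUBE -/

section Leg

variable {d ℓ : ℕ} {hd : 1 ≤ d + 1} {hL : Odd (ℓ + 1) ∧ 1 < ℓ + 1} {m K : ℕ} {Mh k R : ℕ} {P' : Fin (d + 1) → ℕ}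

/-- an exponential kernel with a smaller rate dominates. [cite: Balaban1984PropagatorsII, (2.138) p.247, bookkeeping] -/
private theorem exp_le_exp_of_rate {ρ ρ' t : ℝ} (h : ρ' ≤ ρ) (ht : 0 ≤ t) : Real.exp (-(ρ * t)) ≤ Real.exp (-(ρ' * t)) :=
  Real.exp_le_exp.mpr (neg_le_neg (mul_le_mul_of_nonneg_right h ht))

/-- **THE `n = 0` LEG OF (2.141) FOR THE ENTRY `|(∇G∇*J)(x)|`, PER CUBE, ON THE HÖLDER CLASS** (`L ≥ 5`): there are `ρ > 0` (on `d, L, a₀, a₁`) and, for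
every `0 < ε < 1`, `C_ε ≥ 0` such that on every admissible V1 torus (`M_h = Lᵃ ≥ 8`, `R ≥ 2L²`, `P′ ≥ 5`, cube placed), for every `c′ ≠ 0`, weights `w`,
directions `μ, ν` and cube `□`:
`HasMajorantA (geomT D) (blkV1 hN D) (NormSupp (blkV1) {y′} (‖·‖_ε + |·|)) (∇_μ(h_□G_□h_□)∇*_ν) (1_{Q_□}(y)·1_{Q_□}(y′)·C_ε·e^{−ρ d_T(y,y′)})` — print's
`O(1)e^{−δ₃d}(‖J‖^{ξ′}_ε + |J|)` for the `n = 0` term of the walk, with NO length prefactor.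
[cite: Balaban1984PropagatorsII, Prop. 2.6 (2.138) p.247, (2.141) p.247, (2.92)–(2.94) p.239; Balaban1984PropagatorsI, Prop. 1.2 (1.112) p.36] -/
theorem hD2hGh0_cube (d ℓ : ℕ) (hd : 1 ≤ d + 1) (hL : Odd (ℓ + 1) ∧ 1 < ℓ + 1) {a₀ a₁ : ℝ} (ha₀ : 0 < a₀) (ha₁ : a₀ ≤ a₁) :
    ∃ ρ : ℝ, 0 < ρ ∧ ∀ ε : ℝ, 0 < ε → ε < 1 → ∃ C : ℝ, 0 ≤ C ∧ ∀ (m K : ℕ) {Mh k R : ℕ} {P' : Fin (d + 1) → ℕ}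
      (hN : ∀ μ, N0 ℓ Mh k P' μ = (PV d ℓ m K hd hL).sitesPerDir 0) (D : TDomains d ℓ Mh k P' R) (hk : k ≤ m + K)
      (hMh1 : 1 ≤ Mh) (hP4 : ∀ μ, 4 ≤ P' μ) {a : ℕ} (hMha : Mh = (ℓ + 1) ^ a) (_ : 8 ≤ Mh) (_ : 2 * (ℓ + 1) ^ 2 ≤ R) (_ : ∀ μ, 5 ≤ P' μ)
      (_ : 4 ≤ ℓ) (c : ↥(cubes D.toDomains)) (hpl : Placed ℓ k P' c.1) (w : BondIdx (domT hN D hk) → ℝ) {cf : ℝ} (_ : cf ≠ 0) (μ ν : Fin (d + 1)),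
      HasMajorantA (g := geomT D) (blkV1 hN D)
        (NormSupp (g := geomT D) (blkV1 hN D) (fun y' => ({y'} : Set (geomT D).Site)) (fun _ J => holderV1 hN D ε J + supNormV1 J))
        (DV (P := PV d ℓ m K hd hL) μ cf * (mulOp (hB hN D c) * Gl hN hk hMh1 hP4 hMha c ha₁ hpl w cf * mulOp (hB hN D c)) * DVa (P := PV d ℓ m K hd hL) ν cf)
        (fun y y' => ind (ST D hMh1 hP4 c) y * ind (ST D hMh1 hP4 c) y' * (C * Real.exp (-(ρ * (geomT D).dist y y')))) := by
  obtain ⟨ρA, hρA, HA⟩ := hEGE_cube d ℓ hd hL ha₀ ha₁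
  obtain ⟨ρE, hρE, CE, hCE, hEGin⟩ := hEGin_cube d ℓ hd hL ha₀ ha₁
  obtain ⟨ρF, hρF, CF, hCF, hGEin⟩ := hGEin_cube d ℓ hd hL ha₀ ha₁
  obtain ⟨ρG, hρG, CG, hCG, hGin⟩ := hGin_cube d ℓ hd hL ha₀ ha₁
  have hC1 := C1F_nonneg d ℓ
  refine ⟨min (min ρA ρE) (min ρF ρG), lt_min (lt_min hρA hρE) (lt_min hρF hρG), fun ε hε0 hε1 => ?_⟩
  obtain ⟨CA, hCA, hA⟩ := HA ε hε0 hε1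
  set Λ : ℝ := ((d : ℝ) + 1) * C1F d ℓ with hΛ
  have hΛ0 : 0 ≤ Λ := by positivity
  set L2 : ℝ := (((ℓ + 1 : ℕ) : ℝ)) ^ 2 with hL2
  refine ⟨(1 + Λ) * CA + L2 * CE * C1F d ℓ + L2 * CF * C1F d ℓ + L2 * C1F d ℓ * CG * C1F d ℓ, by positivity, ?_⟩
  intro m K Mh k R P' hN D hk hMh1 hP4 a hMha hM8 hR2 hP5 hℓ c hpl w cf hcf μ ν
  have hMh : 2 ≤ Mh := le_trans (by norm_num) hM8
  have hR : 2 * (ℓ + 1) ≤ R := le_trans (by nlinarith : 2 * (ℓ + 1) ≤ 2 * (ℓ + 1) ^ 2) hR2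
  have hP : ∀ μ, 1 ≤ P' μ := one_le_of_four_le hP4
  have hdnn : ∀ y y' : (geomT D).Site, 0 ≤ (geomT D).dist y y' := fun _ _ => Nat.cast_nonneg _
  set S := ST D hMh1 hP4 c with hS
  set tD : ℝ := |cf| * (C1F d ℓ / (8 / 5 * (bigSide ℓ Mh c.1.1 : ℝ))) with htD
  have htD0 : 0 ≤ tD := by positivity
  -- supports and sizes of the cut-offs
  have hSμ_supp := supp_shB_hB hN hMh1 hP4 c hM8 hR hP5 μ
  have hSν_supp := supp_shB_hB hN hMh1 hP4 c hM8 hR hP5 ν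
  have hSμ_le : ∀ b, |shB (P := PV d ℓ m K hd hL) μ (hB hN D c) b| ≤ 1 := fun b => by rw [shB_apply]; exact abs_hB_le_one hN D hMh1 hP c _
  have hSν_le : ∀ b, |shB (P := PV d ℓ m K hd hL) ν (hB hN D c) b| ≤ 1 := fun b => by rw [shB_apply]; exact abs_hB_le_one hN D hMh1 hP c _
  have hDμ_supp := supp_DV_hB hN hMh1 hP4 c hMh hM8 hR hP5 cf μ
  have hDν_supp := supp_DV_hB hN hMh1 hP4 c hMh hM8 hR hP5 cf ν
  have hDμ_le := abs_DV_hB_le hN c hMh hR hP5 cf μ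
  have hDν_le := abs_DV_hB_le hN c hMh hR hP5 cf ν
  have hsupN : ∀ (y' : (geomT D).Site) (J : PBond (PV d ℓ m K hd hL) 0 → ℝ) (x : PBond (PV d ℓ m K hd hL) 0),
      |J x| ≤ holderV1 hN D ε J + supNormV1 J :=
    fun y' J x => (abs_le_supNormV1 J x).trans (le_add_of_nonneg_left (holderV1_nonneg hN D ε J))
  -- (a) `(S_μh)·E_(μ,+)G_□E_(ν,−)·(S_νh)`: the Hölder-class letter, the right cut-off feeding the reach, the left cut-off
  have hA0 := hA m K hN D hk hMh1 hP4 hMha hMh hR2 hℓ c hpl w cf μ ν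
  have hA1 := hasMajorantA_mul_right_ind (g := geomT D) (blkV1 hN D) S (κ := 1 + Λ) (E := mulOp (shB (P := PV d ℓ m K hd hL) ν (hB hN D c))) hA0
    (fun J y' B hJ _ => normSupp_mulOp hε1.le hΛ0 hSν_le (fun x x' hq => lip_shB_hB hN hk hMh1 hP4 hMha c hM8 hR2 hP5 hpl ν hq) hJ)
    (fun J y' B hJ hy => mulOp_eq_zero_of_region (g := geomT D) (blkV1 hN D) (R := fun y' => ({y'} : Set (geomT D).Site))
      (fun x hx => by
        by_contra hne
        exact hx (hJ.off x hne))
      (fun x hx y'' hmem => by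
        rw [Set.mem_singleton_iff] at hmem
        rw [← hmem]
        exact hSν_supp x hx) hy)
  have hA2 := hasMajorantA_mulOp_left (g := geomT D) (blkV1 hN D) (f := shB (P := PV d ℓ m K hd hL) μ (hB hN D c)) hSμ_le hA1
  have hA3 := hasMajorantA_localise_out (g := geomT D) (blkV1 hN D) hA2 (outLoc_mulOp_mul (g := geomT D) (blkV1 hN D) hSμ_supp _)
  have hA4 := hasMajorantA_smul (g := geomT D) (blkV1 hN D) hA3 (sc hMh1 hP4 c cf)
  -- (b) `(S_μh)·E_(μ,+)G_□·(∇_νh)`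
  have hB0 := hasMajorant_sandwich_in_both (g := geomT D) (blkV1 hN D) (S := S) (s := 1) (t := tD)
    (f := shB (P := PV d ℓ m K hd hL) μ (hB hN D c)) (h := DV (P := PV d ℓ m K hd hL) ν cf (hB hN D c))
    (K := fun y y' => CE * pref cf y * Real.exp (-(ρE * (geomT D).dist y y')))
    (fun y y' => by have := pref_nonneg cf y; positivity) zero_le_one htD0 hSμ_supp hSμ_le hDν_supp hDν_le
    (hEGin m K hN D hk hMh1 hP4 hMha hMh hR2 hℓ c hpl w cf (μ, true))
  have hB1 := hasMajorantA_normSupp_of_sup (g := geomT D) (blkV1 hN D) (N := fun _ J => holderV1 hN D ε J + supNormV1 J) hsupN hB0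
  have hB2 := hasMajorantA_smul (g := geomT D) (blkV1 hN D) hB1 (cf / (((ℓ + 1 : ℕ) : ℝ)) ^ j0 hMh1 hP4 c)
  -- (c) `(∇_μh)·G_□E_(ν,−)·(S_νh)`
  have hC0 := hasMajorant_sandwich_in_both (g := geomT D) (blkV1 hN D) (S := S) (s := tD) (t := 1)
    (f := DV (P := PV d ℓ m K hd hL) μ cf (hB hN D c)) (h := shB (P := PV d ℓ m K hd hL) ν (hB hN D c))
    (K := fun y y' => CF * pref cf y * Real.exp (-(ρF * (geomT D).dist y y')))
    (fun y y' => by have := pref_nonneg cf y; positivity) htD0 zero_le_one hDμ_supp hDμ_le hSν_supp hSν_le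
    (hGEin m K hN D hk hMh1 hP4 hMha hMh hR2 hℓ c hpl w cf (ν, false))
  have hC1 := hasMajorantA_normSupp_of_sup (g := geomT D) (blkV1 hN D) (N := fun _ J => holderV1 hN D ε J + supNormV1 J) hsupN hC0
  have hC2 := hasMajorantA_smul (g := geomT D) (blkV1 hN D) hC1 (cf / (((ℓ + 1 : ℕ) : ℝ)) ^ j0 hMh1 hP4 c)
  -- (d) `(∇_μh)·G_□·(∇_νh)`
  have hD0 := hasMajorant_sandwich_in_both (g := geomT D) (blkV1 hN D) (S := S) (s := tD) (t := tD)
    (f := DV (P := PV d ℓ m K hd hL) μ cf (hB hN D c)) (h := DV (P := PV d ℓ m K hd hL) ν cf (hB hN D c))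
    (K := fun y y' => CG * pref cf y * Real.exp (-(ρG * (geomT D).dist y y')))
    (fun y y' => by have := pref_nonneg cf y; positivity) htD0 htD0 hDμ_supp hDμ_le hDν_supp hDν_le
    (hGin m K hN D hk hMh1 hP4 hMha hMh hR2 hℓ c hpl w cf)
  have hD1 := hasMajorantA_normSupp_of_sup (g := geomT D) (blkV1 hN D) (N := fun _ J => holderV1 hN D ε J + supNormV1 J) hsupN hD0
  -- the operator identity and the sum
  rw [grad2_sandwich_eq hN hk hMh1 hP4 hMha c ha₁ ha₀ hM8 hR2 hpl w hcf μ ν]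
  refine hasMajorantA_mono (g := geomT D) (blkV1 hN D) (hasMajorantA_add _ (hasMajorantA_add _ (hasMajorantA_add _ hA4 hB2) hC2) hD1)
    (fun _ _ _ hμ => hμ.nonneg) fun y y' => ?_
  -- the kernels
  by_cases hy : y ∈ S
  swap
  · rw [ind_of_not_mem hy]; simp
  by_cases hy' : y' ∈ S
  swap
  · rw [ind_of_not_mem hy']; simp
  rw [ind_of_mem hy, ind_of_mem hy']
  set dd := (geomT D).dist y y' with hdd
  have hd0 : 0 ≤ dd := hdnn y y'
  have eA := exp_le_exp_of_rate (ρ := ρA) (ρ' := min (min ρA ρE) (min ρF ρG)) (le_trans (min_le_left _ _) (min_le_left _ _)) hd0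
  have eE := exp_le_exp_of_rate (ρ := ρE) (ρ' := min (min ρA ρE) (min ρF ρG)) (le_trans (min_le_left _ _) (min_le_right _ _)) hd0
  have eF := exp_le_exp_of_rate (ρ := ρF) (ρ' := min (min ρA ρE) (min ρF ρG)) (le_trans (min_le_right _ _) (min_le_left _ _)) hd0
  have eG := exp_le_exp_of_rate (ρ := ρG) (ρ' := min (min ρA ρE) (min ρF ρG)) (le_trans (min_le_right _ _) (min_le_right _ _)) hd0
  set eρ := Real.exp (-(min (min ρA ρE) (min ρF ρG) * dd)) with heρ
  have heρ0 : 0 ≤ eρ := Real.exp_nonneg _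
  have hsc0 := sc_nonneg hMh1 hP4 c cf
  have hscne := sc_ne_zero hMh1 hP4 c hcf
  have habs : |cf / (((ℓ + 1 : ℕ) : ℝ)) ^ j0 hMh1 hP4 c| = |cf| / (((ℓ + 1 : ℕ) : ℝ)) ^ j0 hMh1 hP4 c := by
    rw [abs_div, abs_of_pos (by positivity : (0 : ℝ) < (((ℓ + 1 : ℕ) : ℝ)) ^ j0 hMh1 hP4 c)]
  have hps := pref_scale_le hL hMh1 hP4 c hR2 hcf hy
  have hls := lip_scale_le hL hMh1 hP4 c hR2 hcf hy
  have hll := len_lip_le hMh1 hP4 c hR hy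
  have hlen0 : 0 ≤ (geomT D).len y := by rw [geomT_len]; positivity
  have hcfabs : |cf|⁻¹ * |cf| = 1 := inv_mul_cancel₀ (abs_ne_zero.2 hcf)
  -- (a)
  have h1 : |sc hMh1 hP4 c cf| * (1 * (1 * ((1 + Λ) * ((sc hMh1 hP4 c cf)⁻¹ * (CA * Real.exp (-(ρA * dd))))))) ≤ (1 + Λ) * CA * eρ := by
    rw [abs_of_nonneg hsc0]
    calc sc hMh1 hP4 c cf * (1 * (1 * ((1 + Λ) * ((sc hMh1 hP4 c cf)⁻¹ * (CA * Real.exp (-(ρA * dd)))))))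
        = (sc hMh1 hP4 c cf * (sc hMh1 hP4 c cf)⁻¹) * ((1 + Λ) * CA * Real.exp (-(ρA * dd))) := by ring
      _ = (1 + Λ) * CA * Real.exp (-(ρA * dd)) := by rw [mul_inv_cancel₀ hscne, one_mul]
      _ ≤ (1 + Λ) * CA * eρ := mul_le_mul_of_nonneg_left eA (by positivity)
  -- (b)
  have h2 : |cf / (((ℓ + 1 : ℕ) : ℝ)) ^ j0 hMh1 hP4 c| * (1 * 1 * (1 * tD * (CE * pref cf y * Real.exp (-(ρE * dd))))) ≤ L2 * CE * C1F d ℓ * eρ := by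
    rw [habs]
    calc |cf| / (((ℓ + 1 : ℕ) : ℝ)) ^ j0 hMh1 hP4 c * (1 * 1 * (1 * tD * (CE * pref cf y * Real.exp (-(ρE * dd)))))
        = CE * (|cf| / (((ℓ + 1 : ℕ) : ℝ)) ^ j0 hMh1 hP4 c * pref cf y) * tD * Real.exp (-(ρE * dd)) := by ring
      _ ≤ CE * (L2 * ((geomT D).len y * |cf|⁻¹)) * tD * eρ := by gcongr
      _ = L2 * CE * (|cf|⁻¹ * |cf|) * ((geomT D).len y * (C1F d ℓ / (8 / 5 * (bigSide ℓ Mh c.1.1 : ℝ)))) * eρ := by rw [htD]; ring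
      _ ≤ L2 * CE * 1 * C1F d ℓ * eρ := by rw [hcfabs]; gcongr
      _ = L2 * CE * C1F d ℓ * eρ := by ring
  -- (c)
  have h3 : |cf / (((ℓ + 1 : ℕ) : ℝ)) ^ j0 hMh1 hP4 c| * (1 * 1 * (tD * 1 * (CF * pref cf y * Real.exp (-(ρF * dd))))) ≤ L2 * CF * C1F d ℓ * eρ := by
    rw [habs]
    calc |cf| / (((ℓ + 1 : ℕ) : ℝ)) ^ j0 hMh1 hP4 c * (1 * 1 * (tD * 1 * (CF * pref cf y * Real.exp (-(ρF * dd)))))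
        = CF * (|cf| / (((ℓ + 1 : ℕ) : ℝ)) ^ j0 hMh1 hP4 c * pref cf y) * tD * Real.exp (-(ρF * dd)) := by ring
      _ ≤ CF * (L2 * ((geomT D).len y * |cf|⁻¹)) * tD * eρ := by gcongr
      _ = L2 * CF * (|cf|⁻¹ * |cf|) * ((geomT D).len y * (C1F d ℓ / (8 / 5 * (bigSide ℓ Mh c.1.1 : ℝ)))) * eρ := by rw [htD]; ring
      _ ≤ L2 * CF * 1 * C1F d ℓ * eρ := by rw [hcfabs]; gcongr
      _ = L2 * CF * C1F d ℓ * eρ := by ring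
  -- (d)
  have h4 : 1 * 1 * (tD * tD * (CG * pref cf y * Real.exp (-(ρG * dd)))) ≤ L2 * C1F d ℓ * CG * C1F d ℓ * eρ := by
    calc 1 * 1 * (tD * tD * (CG * pref cf y * Real.exp (-(ρG * dd))))
        = CG * (|cf| * (C1F d ℓ / (8 / 5 * (bigSide ℓ Mh c.1.1 : ℝ))) * pref cf y) * tD * Real.exp (-(ρG * dd)) := by rw [htD]; ring
      _ ≤ CG * (L2 * C1F d ℓ * ((geomT D).len y * |cf|⁻¹)) * tD * eρ := by gcongr
      _ = L2 * C1F d ℓ * CG * (|cf|⁻¹ * |cf|) * ((geomT D).len y * (C1F d ℓ / (8 / 5 * (bigSide ℓ Mh c.1.1 : ℝ)))) * eρ := by rw [htD]; ring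
      _ ≤ L2 * C1F d ℓ * CG * 1 * C1F d ℓ * eρ := by rw [hcfabs]; gcongr
      _ = L2 * C1F d ℓ * CG * C1F d ℓ * eρ := by ring
  have hsum := add_le_add (add_le_add (add_le_add h1 h2) h3) h4
  refine hsum.trans (le_of_eq ?_)
  ring

end Leg

end Literature.MathematicalPhysics.QuantumFieldTheory.Balaban1983to89.B6Grad2NormSuppLegKLevelV1

end
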